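import Summits.ResolutionOfSingularities.ResolutionOfSingularities.Theorems.PurelyInseparableDim4JointLeafPointCharts
import Summits.ResolutionOfSingularities.ResolutionOfSingularities.Theorems.PurelyInseparableDim4JointWaitingMember
import HarnessLib

/-!
# Purely inseparable four-folds: computations for the v3-lite TOY — two INTERSECTING root surfaces, one blown up, the other
# WAITING and blown up next (brick S3 (c) «joint point∘coordinate chains», part 32a, cell `res-dim4-pi`)

[OURS · counted 0] (D-0157 DOOR 2; desk WORD #66 (4)(c), #74 (g), #99 (d); frame `PIDim4.TerminationImpliesOrderReduction`,
S3 (c) v3-lite, memo `S3c-V3-DESIGN.md` Addendum 2; host item stmt-ResolutionOfSingularities-16155, helper). Nothing here proves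
resolution of singularities in dimension ≥ 4 / characteristic `p` — NOT here, not anywhere in this programme. NO certificate is
assembled here: the v3-lite forest step (plan entries with `S.erase j ⊆ S″`, `j ∉ S″`) is the successor's; these are its inputs.

`F = x₁^p x₄ + x₁ x₂^{p−1}(x₃^p − 1)` (variables `x₁…x₄` = `X 0…X 3`), `p ≥ 3`.
* ROOT: the order-`p` parameters satisfy `b₁ = 0 ∧ (b₂ = 0 ∨ b₃ = 1)` (`roots_F_toy`) — two surfaces `V(z,x₁,x₂)`, `V(z,x₁,x₃−1)` meeting
  in a line; member `S = {x₁,x₂}` permissible (`isPermissibleCentre_F_toy`); the WAITING member `(e₃, T = {x₁,x₃})`: `T` permissible for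
  `F(x + e₃) = x₁^p x₄ + x₁x₂^{p−1}x₃^p` (`translate_e₂_F_toy`, `isPermissibleCentre_T_F_toy`).
* STAGE 1 (blow up `S`): chart `x₁` reads `y₄ + y₂^{p−1}y₃^p − y₂^{p−1}` — DEAD (`not_isEquimultiplePoint_pair_zero_F_toy`); chart `x₂` reads
  `G′ = y₁^p y₄ + y₁y₃^p − y₁` whose equimultiple pairs have `b₁ = 0 ∧ b₃ = 1` (`cases_pair_one_F_toy`) = the strict transform of the waiting
  member, i.e. the waiting ENTRY `(x₂, e₃, T)` («agree on T»; `S.erase x₂ = {x₁} ⊆ T`, `x₂ ∉ T`); its permissibility/equimultiplicity are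
  part 31 applied to `isPermissibleCentre_T_F_toy`; its state is `H = y₁^p y₄ + y₁y₃^p` (`step_F_waiting_toy`).
* STAGE 2 (blow up `T` for `H`): chart `y₁` reads `u₄ + u₁u₃^p`, chart `y₃` reads `u₁·(u₁^{p−1}u₄ + u₃)` — no equimultiple pair
  (`not_isEquimultiplePoint_T_H_toy`, `p ≥ 3`). Three nodes, no leaves.

AI-produced formalisation, weaker than expert review. bears_on: LADDER-RESOLUTION:D157-DOOR2 (res-dim4-pi · S3 (c) v3-lite · toy
computations).
-/

set_option linter.dupNamespace false -- D-0017: single-problem summit path `Summit.<S>.<S>.…` by design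

noncomputable section

open MvPolynomial Finset

namespace Summit.ResolutionOfSingularities.ResolutionOfSingularities.Theorems.PIDim4

open Literature.AlgebraicGeometry.Resolution
open Literature.AlgebraicGeometry.Resolution.Hauser2010

namespace Equimultiple

section WaitingToy

variable {K : Type} [Field K] {p : ℕ} [hp : Fact p.Prime] [CharP K p]

/-! ## §1 The root equation -/

omit hp [CharP K p] in
/-- `F` as a sum of three monomials. [folklore] -/
theorem F_toy_eq_monomial_add :
    (X 0 ^ p * X 3 + X 0 * X 1 ^ (p - 1) * X 2 ^ p - X 0 * X 1 ^ (p - 1) : MvPolynomial (Fin 4) K) =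
      monomial (Finsupp.single 0 p + Finsupp.single 3 1) 1 +
        monomial (Finsupp.single 0 1 + Finsupp.single 1 (p - 1) + Finsupp.single 2 p) 1 +
        monomial (Finsupp.single 0 1 + Finsupp.single 1 (p - 1)) (-1) := by
  have h2 : (X 0 * X 1 ^ (p - 1) * X 2 ^ p : MvPolynomial (Fin 4) K) =
      monomial (Finsupp.single 0 1 + Finsupp.single 1 (p - 1) + Finsupp.single 2 p) 1 := by
    rw [X_pow_eq_monomial, X_pow_eq_monomial, X, monomial_mul, monomial_mul, mul_one, mul_one]
  have h3 : (X 0 * X 1 ^ (p - 1) : MvPolynomial (Fin 4) K) = monomial (Finsupp.single 0 1 + Finsupp.single 1 (p - 1)) 1 := by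
    rw [X_pow_eq_monomial, X, monomial_mul, mul_one]
  rw [X_pow_mul_X_eq_monomial, h2, h3, map_neg, ← sub_eq_add_neg]

omit hp [CharP K p] in
/-- The support of `F` lies in its three exponents. [folklore] -/
theorem mem_support_F_toy {d : Fin 4 →₀ ℕ}
    (hd : d ∈ (X 0 ^ p * X 3 + X 0 * X 1 ^ (p - 1) * X 2 ^ p - X 0 * X 1 ^ (p - 1) : MvPolynomial (Fin 4) K).support) :
    d = Finsupp.single 0 p + Finsupp.single 3 1 ∨ d = Finsupp.single 0 1 + Finsupp.single 1 (p - 1) + Finsupp.single 2 p ∨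
      d = Finsupp.single 0 1 + Finsupp.single 1 (p - 1) := by
  rw [F_toy_eq_monomial_add] at hd
  rcases Finset.mem_union.mp (Finset.mem_of_subset MvPolynomial.support_add hd) with h₁ | h₁
  · rcases Finset.mem_union.mp (Finset.mem_of_subset MvPolynomial.support_add h₁) with h₂ | h₂
    · exact Or.inl (Finset.mem_singleton.mp (Finset.mem_of_subset support_monomial_subset h₂))
    · exact Or.inr (Or.inl (Finset.mem_singleton.mp (Finset.mem_of_subset support_monomial_subset h₂)))
  · exact Or.inr (Or.inr (Finset.mem_singleton.mp (Finset.mem_of_subset support_monomial_subset h₁)))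

omit [CharP K p] in
/-- `F` is clean (exponents `1` of `x₄`, `x₁`, `x₁`). [cite: HauserPerlega2019PRIMS, §2 (cleaning)] -/
theorem isClean_F_toy :
    Literature.Barriers.ResolutionOfSingularities.HauserPerlega.IsClean p
      (X 0 ^ p * X 3 + X 0 * X 1 ^ (p - 1) * X 2 ^ p - X 0 * X 1 ^ (p - 1) : MvPolynomial (Fin 4) K) := by
  intro d hd hpth
  have key : ∀ i : Fin 4, d i = 1 → False := fun i hi => by
    have h := hpth i (by rw [Finsupp.mem_support_iff, hi]; exact one_ne_zero)
    rw [hi] at h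
    exact hp.out.one_lt.ne' (Nat.dvd_one.mp h)
  rcases mem_support_F_toy hd with rfl | rfl | rfl
  · exact key 3 (by simp)
  · exact key 0 (by simp)
  · exact key 0 (by simp)

omit hp [CharP K p] in
/-- `F ≠ 0`. [folklore] -/
theorem F_toy_ne_zero : (X 0 ^ p * X 3 + X 0 * X 1 ^ (p - 1) * X 2 ^ p - X 0 * X 1 ^ (p - 1) : MvPolynomial (Fin 4) K) ≠ 0 := by
  intro h
  have hc := congrArg (coeff (Finsupp.single (0 : Fin 4) p + Finsupp.single 3 1)) h
  have n2 : (Finsupp.single (0 : Fin 4) 1 + Finsupp.single 1 (p - 1) + Finsupp.single 2 p) ≠ Finsupp.single 0 p + Finsupp.single 3 1 :=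
    fun h' => by have := DFunLike.congr_fun h' 3; simp at this
  have n3 : (Finsupp.single (0 : Fin 4) 1 + Finsupp.single 1 (p - 1)) ≠ Finsupp.single 0 p + Finsupp.single 3 1 :=
    fun h' => by have := DFunLike.congr_fun h' 3; simp at this
  rw [F_toy_eq_monomial_add, coeff_add, coeff_add, coeff_monomial, if_pos rfl, coeff_monomial, if_neg n2, coeff_monomial, if_neg n3,
    coeff_zero] at hc
  simp at hc

omit [CharP K p] in
/-- **`V(z, x₁, x₂)` is Hironaka-permissible for `z^p + F`.** [cite: HauserPerlega2019PRIMS, §2 (condition (1))] -/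
theorem isPermissibleCentre_F_toy :
    IsPermissibleCentre p ({0, 1} : Finset (Fin 4))
      (X 0 ^ p * X 3 + X 0 * X 1 ^ (p - 1) * X 2 ^ p - X 0 * X 1 ^ (p - 1) : MvPolynomial (Fin 4) K) := by
  have := hp.out.one_le
  refine ⟨⟨0, Finset.mem_insert_self _ _⟩, Finset.le_inf fun d hd => ?_⟩
  rcases mem_support_F_toy hd with rfl | rfl | rfl <;> simp [degIn_pair] <;> exact_mod_cast (by omega)

/-- **The root parameters**: order `p` at `(a, b)` forces `b₁ = 0` (`∂F/∂x₄ = x₁^p`) and `b₂ = 0 ∨ b₃ = 1`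
(`∂F/∂x₁ = x₂^{p−1}(x₃^p − 1) + p·(…)`) — the two INTERSECTING surfaces. [cite: Hauser2010, §F (equiconstant points)] -/
theorem roots_F_toy (b : Fin 4 → K)
    (H : ∀ d : Fin 4 →₀ ℕ, d ≠ 0 → d.degree < p → coeff d (PointBlowup.translate b
      (X 0 ^ p * X 3 + X 0 * X 1 ^ (p - 1) * X 2 ^ p - X 0 * X 1 ^ (p - 1) : MvPolynomial (Fin 4) K)) = 0) :
    b 0 = 0 ∧ (b 1 = 0 ∨ b 2 = 1) := by
  have hp0 : p ≠ 0 := hp.out.ne_zero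
  have h3 := eval_pderiv_eq_zero_of_forall_coeff b _ H 3
  have h0 := eval_pderiv_eq_zero_of_forall_coeff b _ H 0
  simp [(pderiv (3 : Fin 4)).leibniz_pow, (pderiv (0 : Fin 4)).leibniz_pow, hp0] at h3 h0
  refine ⟨h3, ?_⟩
  have key : b 1 ^ (p - 1) * (b 2 ^ p - 1) = 0 := by linear_combination h0
  rcases mul_eq_zero.mp key with h | h
  · have hp2 := hp.out.two_le
    exact Or.inl (pow_eq_zero_iff (by omega : p - 1 ≠ 0) |>.mp h)
  · right
    have : (b 2 - 1) ^ p = 0 := by rw [sub_pow_char, one_pow]; exact h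
    exact sub_eq_zero.mp (pow_eq_zero_iff hp0 |>.mp this)

/-- **`F(x + e₃) = x₁^p x₄ + x₁ x₂^{p−1} x₃^p`** (the waiting member re-centred). [cite: Hauser2010, §F (translation)] -/
theorem translate_e₂_F_toy :
    PointBlowup.translate (Pi.single 2 1 : Fin 4 → K)
        (X 0 ^ p * X 3 + X 0 * X 1 ^ (p - 1) * X 2 ^ p - X 0 * X 1 ^ (p - 1) : MvPolynomial (Fin 4) K) =
      X 0 ^ p * X 3 + X 0 * X 1 ^ (p - 1) * X 2 ^ p := by
  unfold PointBlowup.translate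
  simp only [map_add, map_sub, map_mul, map_pow, aeval_X, Pi.single_eq_same, C_1,
    Pi.single_eq_of_ne (show (0 : Fin 4) ≠ 2 by decide), Pi.single_eq_of_ne (show (1 : Fin 4) ≠ 2 by decide),
    Pi.single_eq_of_ne (show (3 : Fin 4) ≠ 2 by decide), C_0, add_zero]
  rw [add_pow_char, one_pow]
  ring

omit hp [CharP K p] in
/-- **The waiting member `T = {x₁, x₃}` is permissible for `F(x + e₃)`.** [cite: HauserPerlega2019PRIMS, §2 (condition (1))] -/
theorem isPermissibleCentre_T_F_toy :
    IsPermissibleCentre p ({0, 2} : Finset (Fin 4)) (X 0 ^ p * X 3 + X 0 * X 1 ^ (p - 1) * X 2 ^ p : MvPolynomial (Fin 4) K) := by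
  have h2 : (X 0 * X 1 ^ (p - 1) * X 2 ^ p : MvPolynomial (Fin 4) K) =
      monomial (Finsupp.single 0 1 + Finsupp.single 1 (p - 1) + Finsupp.single 2 p) 1 := by
    rw [X_pow_eq_monomial, X_pow_eq_monomial, X, monomial_mul, monomial_mul, mul_one, mul_one]
  have hdeg : ∀ d : Fin 4 →₀ ℕ, CentreBlowup.degIn ({0, 2} : Finset (Fin 4)) d = d 0 + d 2 := fun d => by
    rw [CentreBlowup.degIn, Finset.sum_pair (by decide : (0 : Fin 4) ≠ 2)]
  refine ⟨⟨0, Finset.mem_insert_self _ _⟩, Finset.le_inf fun d hd => ?_⟩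
  rw [X_pow_mul_X_eq_monomial, h2] at hd
  rcases Finset.mem_union.mp (Finset.mem_of_subset MvPolynomial.support_add hd) with h | h <;>
    have := Finset.mem_singleton.mp (Finset.mem_of_subset support_monomial_subset h) <;> subst this <;> simp [hdeg]

/-! ## §2 Stage 1: the blow-up of `V(z, x₁, x₂)` -/

omit [CharP K p] in
/-- **The `x₁`-chart reads `y₄ + y₂^{p−1}y₃^p − y₂^{p−1}`.** [cite: HauserPerlega2019PRIMS, §2 (the x₁-chart)] -/
theorem chartTransform_pair_zero_F_toy :
    CentreBlowup.chartTransform p ({0, 1} : Finset (Fin 4)) 0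
        (X 0 ^ p * X 3 + X 0 * X 1 ^ (p - 1) * X 2 ^ p - X 0 * X 1 ^ (p - 1) : MvPolynomial (Fin 4) K) =
      X 3 + X 1 ^ (p - 1) * X 2 ^ p - X 1 ^ (p - 1) := by
  have hp1 : 1 + (p - 1) = p := by have := hp.out.one_le; omega
  rw [F_toy_eq_monomial_add, CentreBlowup.chartTransform_add, CentreBlowup.chartTransform_monomial_add_monomial,
    CentreBlowup.chartTransform_monomial]
  simp only [CentreBlowup.chartExponent, degIn_pair]
  have e1 : (Finsupp.single 0 p + Finsupp.single 3 1 : Fin 4 →₀ ℕ).update 0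
      ((Finsupp.single 0 p + Finsupp.single 3 1 : Fin 4 →₀ ℕ) 0 + (Finsupp.single 0 p + Finsupp.single 3 1 : Fin 4 →₀ ℕ) 1 - p) =
        Finsupp.single 3 1 := by
    ext i; fin_cases i <;> simp [Finsupp.update_apply]
  have e2 : (Finsupp.single 0 1 + Finsupp.single 1 (p - 1) + Finsupp.single 2 p : Fin 4 →₀ ℕ).update 0
      ((Finsupp.single 0 1 + Finsupp.single 1 (p - 1) + Finsupp.single 2 p : Fin 4 →₀ ℕ) 0 +
        (Finsupp.single 0 1 + Finsupp.single 1 (p - 1) + Finsupp.single 2 p : Fin 4 →₀ ℕ) 1 - p) =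
        Finsupp.single 1 (p - 1) + Finsupp.single 2 p := by
    ext i; fin_cases i <;> simp [Finsupp.update_apply]; omega
  have e3 : (Finsupp.single 0 1 + Finsupp.single 1 (p - 1) : Fin 4 →₀ ℕ).update 0
      ((Finsupp.single 0 1 + Finsupp.single 1 (p - 1) : Fin 4 →₀ ℕ) 0 + (Finsupp.single 0 1 + Finsupp.single 1 (p - 1) : Fin 4 →₀ ℕ) 1 - p) =
        Finsupp.single 1 (p - 1) := by
    ext i; fin_cases i <;> simp [Finsupp.update_apply]; omega
  have h₂ : (monomial (Finsupp.single 1 (p - 1) + Finsupp.single 2 p) (1 : K) : MvPolynomial (Fin 4) K) = X 1 ^ (p - 1) * X 2 ^ p := by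
    rw [X_pow_eq_monomial, X_pow_eq_monomial, monomial_mul, mul_one]
  rw [e1, e2, e3, h₂, ← X_pow_eq_monomial, map_neg, ← X_pow_eq_monomial, ← sub_eq_add_neg, pow_one]

omit [CharP K p] in
/-- **The `x₂`-chart reads `G′ = y₁^p y₄ + y₁y₃^p − y₁`.** [cite: HauserPerlega2019PRIMS, §2 (the x₁-chart)] -/
theorem chartTransform_pair_one_F_toy :
    CentreBlowup.chartTransform p ({0, 1} : Finset (Fin 4)) 1
        (X 0 ^ p * X 3 + X 0 * X 1 ^ (p - 1) * X 2 ^ p - X 0 * X 1 ^ (p - 1) : MvPolynomial (Fin 4) K) =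
      X 0 ^ p * X 3 + X 0 * X 2 ^ p - X 0 := by
  have hp1 : 1 + (p - 1) = p := by have := hp.out.one_le; omega
  rw [F_toy_eq_monomial_add, CentreBlowup.chartTransform_add, CentreBlowup.chartTransform_monomial_add_monomial,
    CentreBlowup.chartTransform_monomial]
  simp only [CentreBlowup.chartExponent, degIn_pair]
  have e1 : (Finsupp.single 0 p + Finsupp.single 3 1 : Fin 4 →₀ ℕ).update 1
      ((Finsupp.single 0 p + Finsupp.single 3 1 : Fin 4 →₀ ℕ) 0 + (Finsupp.single 0 p + Finsupp.single 3 1 : Fin 4 →₀ ℕ) 1 - p) =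
        Finsupp.single 0 p + Finsupp.single 3 1 := by
    ext i; fin_cases i <;> simp [Finsupp.update_apply]
  have e2 : (Finsupp.single 0 1 + Finsupp.single 1 (p - 1) + Finsupp.single 2 p : Fin 4 →₀ ℕ).update 1
      ((Finsupp.single 0 1 + Finsupp.single 1 (p - 1) + Finsupp.single 2 p : Fin 4 →₀ ℕ) 0 +
        (Finsupp.single 0 1 + Finsupp.single 1 (p - 1) + Finsupp.single 2 p : Fin 4 →₀ ℕ) 1 - p) =
        Finsupp.single 0 1 + Finsupp.single 2 p := by
    ext i; fin_cases i <;> simp [Finsupp.update_apply]; omega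
  have e3 : (Finsupp.single 0 1 + Finsupp.single 1 (p - 1) : Fin 4 →₀ ℕ).update 1
      ((Finsupp.single 0 1 + Finsupp.single 1 (p - 1) : Fin 4 →₀ ℕ) 0 + (Finsupp.single 0 1 + Finsupp.single 1 (p - 1) : Fin 4 →₀ ℕ) 1 - p) =
        Finsupp.single 0 1 := by
    ext i; fin_cases i <;> simp [Finsupp.update_apply]; omega
  have h₂ : (monomial (Finsupp.single 0 1 + Finsupp.single 2 p) (1 : K) : MvPolynomial (Fin 4) K) = X 0 * X 2 ^ p := by
    rw [X_pow_eq_monomial, X, monomial_mul, mul_one]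
  rw [e1, e2, e3, ← X_pow_mul_X_eq_monomial, h₂, map_neg, ← sub_eq_add_neg]
  rfl

omit [CharP K p] in
/-- **The `x₁`-chart is DEAD**: the linear coefficient of `y₄` is `1`. [cite: Hauser2010, §F (equiconstant points)] -/
theorem not_isEquimultiplePoint_pair_zero_F_toy [DecidableEq K] (b : Fin 4 → K) (s : State K)
    (hs : s.F = X 0 ^ p * X 3 + X 0 * X 1 ^ (p - 1) * X 2 ^ p - X 0 * X 1 ^ (p - 1)) :
    ¬ CentreBlowup.IsEquimultiplePoint p ({0, 1} : Finset (Fin 4)) 0 b s := by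
  intro h
  unfold CentreBlowup.IsEquimultiplePoint CentreBlowup.pointTransform at h
  rw [hs, chartTransform_pair_zero_F_toy] at h
  have h3 := h (Finsupp.single 3 1) (Finsupp.single_ne_zero.mpr one_ne_zero) (by rw [Finsupp.degree_single]; exact hp.out.one_lt)
  rw [coeff_single_one_translate] at h3
  simp [(pderiv (3 : Fin 4)).leibniz_pow] at h3

/-- **The equimultiple pairs of the `x₂`-chart lie on the strict transform of the waiting member**: `b₁ = 0` (coefficient `b₁^p` of
`y₄`) and `b₃ = 1` (coefficient `b₃^p − 1` of `y₁`). [cite: Hauser2010, §F (equiconstant points)] -/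
theorem cases_pair_one_F_toy [DecidableEq K] {b : Fin 4 → K} (s : State K)
    (hs : s.F = X 0 ^ p * X 3 + X 0 * X 1 ^ (p - 1) * X 2 ^ p - X 0 * X 1 ^ (p - 1))
    (h : CentreBlowup.IsEquimultiplePoint p ({0, 1} : Finset (Fin 4)) 1 b s) : b 0 = 0 ∧ b 2 = 1 := by
  have hp0 : p ≠ 0 := hp.out.ne_zero
  unfold CentreBlowup.IsEquimultiplePoint CentreBlowup.pointTransform at h
  rw [hs, chartTransform_pair_one_F_toy] at h
  have h3 := eval_pderiv_eq_zero_of_forall_coeff b _ h 3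
  have h0 := eval_pderiv_eq_zero_of_forall_coeff b _ h 0
  simp [(pderiv (3 : Fin 4)).leibniz_pow, (pderiv (0 : Fin 4)).leibniz_pow, hp0] at h3 h0
  refine ⟨h3, ?_⟩
  have : (b 2 - 1) ^ p = 0 := by rw [sub_pow_char, one_pow]; linear_combination h0
  exact sub_eq_zero.mp (pow_eq_zero_iff hp0 |>.mp this)

/-- **The waiting entry's state**: `(step p {x₁,x₂} x₂ e₃ (F, 0, ∅)).F = H = y₁^p y₄ + y₁ y₃^p` (`G′(y + e₃) = H`, already clean).
[cite: Hauser2010, §§F–G] [cite: HauserPerlega2019PRIMS, §2 (cleaning)] -/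
theorem step_F_waiting_toy [DecidableEq K] :
    (CentreBlowup.step p ({0, 1} : Finset (Fin 4)) 1 (Pi.single 2 1)
        (⟨X 0 ^ p * X 3 + X 0 * X 1 ^ (p - 1) * X 2 ^ p - X 0 * X 1 ^ (p - 1), 0, ∅⟩ : State K)).F =
      X 0 ^ p * X 3 + X 0 * X 2 ^ p := by
  show deletePthPowers p (PointBlowup.translate (Pi.single 2 1) (CentreBlowup.chartTransform p ({0, 1} : Finset (Fin 4)) 1
    (X 0 ^ p * X 3 + X 0 * X 1 ^ (p - 1) * X 2 ^ p - X 0 * X 1 ^ (p - 1) : MvPolynomial (Fin 4) K))) = _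
  have htr : PointBlowup.translate (Pi.single 2 1 : Fin 4 → K) (X 0 ^ p * X 3 + X 0 * X 2 ^ p - X 0 : MvPolynomial (Fin 4) K) =
      X 0 ^ p * X 3 + X 0 * X 2 ^ p := by
    unfold PointBlowup.translate
    simp only [map_add, map_sub, map_mul, map_pow, aeval_X, Pi.single_eq_same, C_1,
      Pi.single_eq_of_ne (show (0 : Fin 4) ≠ 2 by decide), Pi.single_eq_of_ne (show (3 : Fin 4) ≠ 2 by decide), C_0, add_zero]
    rw [add_pow_char, one_pow]
    ring
  have hclean : Literature.Barriers.ResolutionOfSingularities.HauserPerlega.IsClean p (X 0 ^ p * X 3 + X 0 * X 2 ^ p : MvPolynomial (Fin 4) K) := by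
    intro d hd hpth
    have h2 : (X 0 * X 2 ^ p : MvPolynomial (Fin 4) K) = monomial (Finsupp.single 0 1 + Finsupp.single 2 p) 1 := by
      rw [X_pow_eq_monomial, X, monomial_mul, mul_one]
    rw [X_pow_mul_X_eq_monomial, h2] at hd
    have key : ∀ i : Fin 4, d i = 1 → False := fun i hi => by
      have h := hpth i (by rw [Finsupp.mem_support_iff, hi]; exact one_ne_zero)
      rw [hi] at h
      exact hp.out.one_lt.ne' (Nat.dvd_one.mp h)
    rcases Finset.mem_union.mp (Finset.mem_of_subset MvPolynomial.support_add hd) with h | h <;>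
      have := Finset.mem_singleton.mp (Finset.mem_of_subset support_monomial_subset h) <;> subst this
    · exact key 3 (by simp)
    · exact key 0 (by simp)
  rw [chartTransform_pair_one_F_toy, htr]
  exact Literature.Barriers.ResolutionOfSingularities.HauserPerlega.deletePthPowers_eq_self hclean

/-! ## §3 Stage 2: the blow-up of the waiting member `V(z, y₁, y₃)` applied to `H` -/

omit hp [CharP K p] in
/-- `Σ_{i ∈ {y₁,y₃}} dᵢ = d₁ + d₃`. [folklore] -/
theorem degIn_pair₀₂ (d : Fin 4 →₀ ℕ) : CentreBlowup.degIn ({0, 2} : Finset (Fin 4)) d = d 0 + d 2 := by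
  rw [CentreBlowup.degIn, Finset.sum_pair (by decide : (0 : Fin 4) ≠ 2)]

omit hp [CharP K p] in
/-- **The `y₁`-chart of the blow-up of `V(z, y₁, y₃)` applied to `H` reads `u₄ + u₁u₃^p`.** [cite: HauserPerlega2019PRIMS, §2] -/
theorem chartTransform_T_zero_H_toy :
    CentreBlowup.chartTransform p ({0, 2} : Finset (Fin 4)) 0 (X 0 ^ p * X 3 + X 0 * X 2 ^ p : MvPolynomial (Fin 4) K) =
      X 3 + X 0 * X 2 ^ p := by
  have h2 : (X 0 * X 2 ^ p : MvPolynomial (Fin 4) K) = monomial (Finsupp.single 0 1 + Finsupp.single 2 p) 1 := by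
    rw [X_pow_eq_monomial, X, monomial_mul, mul_one]
  rw [X_pow_mul_X_eq_monomial, h2, CentreBlowup.chartTransform_monomial_add_monomial]
  simp only [CentreBlowup.chartExponent, degIn_pair₀₂]
  have e1 : (Finsupp.single 0 p + Finsupp.single 3 1 : Fin 4 →₀ ℕ).update 0
      ((Finsupp.single 0 p + Finsupp.single 3 1 : Fin 4 →₀ ℕ) 0 + (Finsupp.single 0 p + Finsupp.single 3 1 : Fin 4 →₀ ℕ) 2 - p) =
        Finsupp.single 3 1 := by
    ext i; fin_cases i <;> simp [Finsupp.update_apply]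
  have e2 : (Finsupp.single 0 1 + Finsupp.single 2 p : Fin 4 →₀ ℕ).update 0
      ((Finsupp.single 0 1 + Finsupp.single 2 p : Fin 4 →₀ ℕ) 0 + (Finsupp.single 0 1 + Finsupp.single 2 p : Fin 4 →₀ ℕ) 2 - p) =
        Finsupp.single 0 1 + Finsupp.single 2 p := by
    ext i; fin_cases i <;> simp [Finsupp.update_apply]
  rw [e1, e2]
  rfl

omit [CharP K p] in
/-- **The `y₃`-chart of the blow-up of `V(z, y₁, y₃)` applied to `H` reads `u₁ · (u₁^{p−1} u₄ + u₃)`.** [cite: HauserPerlega2019PRIMS, §2] -/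
theorem chartTransform_T_two_H_toy :
    CentreBlowup.chartTransform p ({0, 2} : Finset (Fin 4)) 2 (X 0 ^ p * X 3 + X 0 * X 2 ^ p : MvPolynomial (Fin 4) K) =
      X 0 * (X 0 ^ (p - 1) * X 3 + X 2) := by
  have hp1 : 1 + (p - 1) = p := by have := hp.out.one_le; omega
  have h2 : (X 0 * X 2 ^ p : MvPolynomial (Fin 4) K) = monomial (Finsupp.single 0 1 + Finsupp.single 2 p) 1 := by
    rw [X_pow_eq_monomial, X, monomial_mul, mul_one]
  rw [X_pow_mul_X_eq_monomial, h2, CentreBlowup.chartTransform_monomial_add_monomial]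
  simp only [CentreBlowup.chartExponent, degIn_pair₀₂]
  have e1 : (Finsupp.single 0 p + Finsupp.single 3 1 : Fin 4 →₀ ℕ).update 2
      ((Finsupp.single 0 p + Finsupp.single 3 1 : Fin 4 →₀ ℕ) 0 + (Finsupp.single 0 p + Finsupp.single 3 1 : Fin 4 →₀ ℕ) 2 - p) =
        Finsupp.single 0 1 + (Finsupp.single 0 (p - 1) + Finsupp.single 3 1) := by
    ext i; fin_cases i <;> simp [Finsupp.update_apply]; omega
  have e2 : (Finsupp.single 0 1 + Finsupp.single 2 p : Fin 4 →₀ ℕ).update 2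
      ((Finsupp.single 0 1 + Finsupp.single 2 p : Fin 4 →₀ ℕ) 0 + (Finsupp.single 0 1 + Finsupp.single 2 p : Fin 4 →₀ ℕ) 2 - p) =
        Finsupp.single 0 1 + Finsupp.single 2 1 := by
    ext i; fin_cases i <;> simp [Finsupp.update_apply]
  have h₁ : (monomial (Finsupp.single 0 1 + (Finsupp.single 0 (p - 1) + Finsupp.single 3 1)) (1 : K) : MvPolynomial (Fin 4) K) =
      X 0 * (X 0 ^ (p - 1) * X 3) := by
    rw [X_pow_eq_monomial, X, X, monomial_mul, monomial_mul, mul_one, mul_one]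
  have h₂' : (monomial (Finsupp.single 0 1 + Finsupp.single 2 1) (1 : K) : MvPolynomial (Fin 4) K) = X 0 * X 2 := by
    rw [X, X, monomial_mul, mul_one]
  rw [e1, e2, h₁, h₂', ← mul_add]

omit hp in
/-- **STAGE 2 IS DEAD** (`p ≥ 3`): no pair over the waiting member's blow-up is equimultiple — chart `y₁`: the linear coefficient of
`u₄` is `1`; chart `y₃`: the linear coefficient of `u₃` is `b₁` (so `b₁ = 0`) and then `u₁u₃` has coefficient `1`.
[cite: Hauser2010, §F (equiconstant points)] -/
theorem not_isEquimultiplePoint_T_H_toy [DecidableEq K] (hp3 : 3 ≤ p) {k : Fin 4} (hk : k ∈ ({0, 2} : Finset (Fin 4)))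
    (b : Fin 4 → K) (hbk : b k = 0) (s : State K) (hs : s.F = X 0 ^ p * X 3 + X 0 * X 2 ^ p) :
    ¬ CentreBlowup.IsEquimultiplePoint p ({0, 2} : Finset (Fin 4)) k b s := by
  haveI : Fact p.Prime := ⟨by
    rcases CharP.char_is_prime_or_zero K p with h | h
    · exact h
    · omega⟩
  have hp1 : 1 < p := by omega
  intro h
  unfold CentreBlowup.IsEquimultiplePoint CentreBlowup.pointTransform at h
  rw [hs] at h
  rcases Finset.mem_insert.mp hk with rfl | hk2
  · rw [chartTransform_T_zero_H_toy] at h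
    have h3 := h (Finsupp.single 3 1) (Finsupp.single_ne_zero.mpr one_ne_zero) (by rw [Finsupp.degree_single]; exact hp1)
    rw [coeff_single_one_translate] at h3
    simp [(pderiv (3 : Fin 4)).leibniz_pow] at h3
  · have hk' : k = 2 := Finset.mem_singleton.mp hk2
    subst hk'
    rw [chartTransform_T_two_H_toy] at h
    have h2 := h (Finsupp.single 2 1) (Finsupp.single_ne_zero.mpr one_ne_zero) (by rw [Finsupp.degree_single]; exact hp1)
    rw [coeff_single_one_translate] at h2
    simp [(pderiv (2 : Fin 4)).leibniz_pow] at h2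
    have hb0 : b 0 = 0 := h2
    have h02 := h (Finsupp.single 0 1 + Finsupp.single 2 1) (by
        intro h0; have := DFunLike.congr_fun h0 0; simp at this)
      (by rw [map_add, Finsupp.degree_single, Finsupp.degree_single]; omega)
    rw [coeff_pair_translate_X_mul 0 2 b hb0] at h02
    simp [(pderiv (2 : Fin 4)).leibniz_pow] at h02

end WaitingToy

end Equimultiple

end Summit.ResolutionOfSingularities.ResolutionOfSingularities.Theorems.PIDim4

end
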